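import Summits.QuantumFields.YangMills.Theorems.F4SubCurvatureDoorGlobalReductionCertificate
import Summits.QuantumFields.YangMills.Theorems.F4SubCurvatureDoorMirrorAnalyticityRegistered
import Mathlib
import HarnessLib

/-!
# Transverse slice — FIRST RUNG for the heart `stub_planarRigidity`: the BOUNDED sub-claim (statements; two small certified glues)

LINE g19-A «transverse slice» on crux ⟨stmt-QuantumFields-23035⟩ `F4SubCurvatureDoor.ShortRootRigidity`
(skeleton `Cruxes/ShortRootRigidity/Lines/transverse_slice.lean`, stub plans Addendum 4).  idea-crit-4 g8's PRICE P1 isolated the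
sub-claim P₀ of `PlanarRigidity` for kernels BOUNDED at the origin (where the budget conjunct is vacuous).  This file TYPES that rung and the
measure-level statement behind it, so that a free hand can land them BY NAME (`--supports stmt-QuantumFields-23035`):

* `BoundedPlanarConstancy` — a planar-class kernel bounded near `0` is constant off `0` (hence radial: `planarRigidity_of_bounded`, proved here);
* `TwoMirrorLFConstancy` — the engine: a Laplace–Fourier transform `k(y) = ∫ e^{−E|y₀|} cos(p y₁) dμ(E,p)` of a FINITE positive measure that is
  invariant under a rotation by an angle `α` with `cos α ≠ 0`, `sin α ≠ 0` is constant; `HexagonalLFConstancy` is the case `α = π/3`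
  (`hexagonal_of_twoMirror`, proved here).  Sharp at `α = π/2`: `e^{−|y₀|} + e^{−|y₁|}`.

PROOF SKETCH of `TwoMirrorLFConstancy` (stub plans Addendum 4): `ν := k̂` is a finite positive measure which, along every line parallel to the mirror
normal `u₁ = e₀`, is «atom at the foot on `u₁^⊥` + an a.c. Cauchy mixture, Stieltjes in distance²»; rotation invariance transports this to `u₂ = ρ_α u₁`.
(1) `u₁^⊥` meets each `u₂`-fibre in one point (`cos α ≠ 0`) ⇒ `ν(u₁^⊥ ∖ 0) = 0`; (2) the transversal marginal is `≪` Lebesgue (`sin α ≠ 0`) ⇒ `ν = cδ₀ + F d²q`,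
`F ∈ L¹`; (3) Stieltjes tails: `F ≥ a(s)/t²` far out on a non-zero `u₁`-fibre and fibre mass `≥ 2|t|·F` on `u₂`-fibres ⇒ the `u₂`-transversal mass is
`≳ 2a cos α sin α/|s₂|`, not integrable ⇒ `F = 0`.  The passage `InPlanarClass ∧ bounded ⇒ LF with finite μ` is Berg–Christensen–Ressel (bounded
positive-definite functions on the *-semigroup `(0,∞) × ℝ`).  HONEST LABEL: statements + two one-line glues; the rung itself is NOT proved here; nothing
about the singular case of `PlanarRigidity`, C3, ⟨23035⟩, R2d or any summit.
-/

noncomputable section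

open MeasureTheory Filter Topology
open scoped BigOperators

namespace Summit.QuantumFields.YangMills.Cruxes.ShortRootRigidity.TransverseSlice.BoundedRung

open Literature.MathematicalPhysics.QuantumLattice

/-- The slicing plane `ℝ²` (character-identical to the skeleton). -/
abbrev E2 := EuclideanSpace ℝ (Fin 2)

/-- The hexagonal reflection `σ_{n'}`, `n' = (1/2, √3/2)` (character-identical to the skeleton). -/
def hexReflection (y : E2) : E2 :=
  (WithLp.equiv 2 (Fin 2 → ℝ)).symm ![y 0 / 2 - Real.sqrt 3 / 2 * y 1, -(Real.sqrt 3 / 2 * y 0) - y 1 / 2]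

/-- THE PLANAR CLASS (character-identical to the skeleton's `InPlanarClass`). -/
def InPlanarClass (k : E2 → ℝ) : Prop :=
  ContinuousOn k {y | y ≠ 0} ∧
  (∃ C : ℝ, ∀ y, 1 ≤ ‖y‖ → |k y| ≤ C) ∧
  (∀ y, k (timeReflection 2 y) = k y) ∧
  (∀ y, k (hexReflection y) = k y) ∧
  (∀ y, k (-y) = k y) ∧
  (∀ (m : ℕ) (y : Fin m → E2) (c : Fin m → ℝ), (∀ i, 0 < y i 0) →
      0 ≤ ∑ i, ∑ j, c i * c j * k (timeReflection 2 (y i) - y j)) ∧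
  Tendsto (fun y : E2 => ‖y‖ ^ 6 * k y) (𝓝[≠] 0) (𝓝 0)

/-- RUNG «BOUNDED PLANAR CONSTANCY»: a planar-class kernel that is bounded off the origin is constant off the origin. -/
def BoundedPlanarConstancy : Prop :=
  ∀ k : E2 → ℝ, InPlanarClass k → (∃ C : ℝ, ∀ y : E2, y ≠ 0 → |k y| ≤ C) → ∃ c : ℝ, ∀ y : E2, y ≠ 0 → k y = c

/-- Certified glue: the rung gives `PlanarRigidity` (the skeleton's conclusion, verbatim shape) for kernels bounded off `0`. -/
theorem planarRigidity_of_bounded (h : BoundedPlanarConstancy) :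
    ∀ k : E2 → ℝ, InPlanarClass k → (∃ C : ℝ, ∀ y : E2, y ≠ 0 → |k y| ≤ C) →
      ∀ (R : E2 ≃ₗᵢ[ℝ] E2) (y : E2), y ≠ 0 → k (R y) = k y := by
  intro k hk hb R y hy
  obtain ⟨c, hc⟩ := h k hk hb
  have hRy : R y ≠ 0 := fun h0 => hy (by simpa using congrArg R.symm h0)
  rw [hc (R y) hRy, hc y hy]

/-- Rotation of the plane by the angle `α`. [problem-side definition] -/
def rot (α : ℝ) (y : E2) : E2 :=
  (WithLp.equiv 2 (Fin 2 → ℝ)).symm ![Real.cos α * y 0 - Real.sin α * y 1, Real.sin α * y 0 + Real.cos α * y 1]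

/-- The planar Laplace–Fourier transform of a measure `μ` on `(E, p) ∈ ℝ × ℝ` along the mirror normal `e₀`. [problem-side definition] -/
def lf (μ : Measure (ℝ × ℝ)) (y : E2) : ℝ :=
  ∫ z, Real.exp (-(z.1 * |y 0|)) * Real.cos (z.2 * y 1) ∂μ

/-- ENGINE «TWO NON-PERPENDICULAR RP MIRRORS»: the LF transform of a finite positive measure supported in `E ≥ 0` which is invariant under a
rotation by `α` with `cos α ≠ 0`, `sin α ≠ 0` is constant (equivalently `μ = μ(univ)·δ₀`).  Sharp at `α = π/2`. -/
def TwoMirrorLFConstancy : Prop :=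
  ∀ α : ℝ, Real.cos α ≠ 0 → Real.sin α ≠ 0 →
    ∀ μ : Measure (ℝ × ℝ), IsFiniteMeasure μ → μ {z | z.1 < 0} = 0 →
      (∀ y : E2, lf μ (rot α y) = lf μ y) → ∀ y : E2, lf μ y = lf μ 0

/-- The hexagonal case `α = π/3` of the engine (what the D₆ symmetry of a bounded planar-class kernel supplies). -/
def HexagonalLFConstancy : Prop :=
  ∀ μ : Measure (ℝ × ℝ), IsFiniteMeasure μ → μ {z | z.1 < 0} = 0 →
    (∀ y : E2, lf μ (rot (Real.pi / 3) y) = lf μ y) → ∀ y : E2, lf μ y = lf μ 0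

/-- Certified glue: the engine gives the hexagonal case (`cos(π/3) = 1/2`, `sin(π/3) = √3/2`). -/
theorem hexagonal_of_twoMirror (h : TwoMirrorLFConstancy) : HexagonalLFConstancy := by
  intro μ hfin hsupp hinv
  have hc : Real.cos (Real.pi / 3) ≠ 0 := by rw [Real.cos_pi_div_three]; norm_num
  have hs : Real.sin (Real.pi / 3) ≠ 0 := by
    rw [Real.sin_pi_div_three]; positivity
  exact h (Real.pi / 3) hc hs μ hfin hsupp hinv

end Summit.QuantumFields.YangMills.Cruxes.ShortRootRigidity.TransverseSlice.BoundedRung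

end
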